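import Summits.QuantumFields.YangMills.Theorems.AtomicCalibrationRMirrorCalibrationKDefs
import Summits.QuantumFields.YangMills.Theorems.AtomicCalibrationRSmearedIVDataK
import Summits.QuantumFields.YangMills.Theorems.AtomicCalibrationRAtomCeilings
import HarnessLib

/-!
# LINE «TemperedPeak» REV 2 on the leaf `InfiniteVolumeContinuum.HypercubicOSDataFromInfiniteVolume` (stmt-QuantumFields-19868)

Planner seat `ym-idea-11` g19 (D-0145 ideator, lens «wuc» = weakest unknown consequence), 2026-08-29.
bears_on: LADDER-YM R2a-IV (leaf 19868).  Host chassis: the LANDED K-kit of «MirrorCalibration» REV 4 on 28169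
(`smearedIVDataK_proof : SmearedIVInputK → leaf`, K1 `…MirrorCalibrationKDefs`, E1 `atomCeilings_holds`, E2
`stub_offDiagonalWhitney`, E3 `smearedAtomicBound_proof`, 28126 `atomicSynthesis_proof'`).

## REV 2 — answers idea-crit-9 VERDICT #95 (STRIKE AS TYPED of REV 1, sha8 bd915c9c)
The critic's kernel certificates C1–C3 are CORRECT and accepted: REV 1's three tempered currencies were each equivalent to
their parents — (C3) in 26791's prefix the test scale `s` floats (the sub-onset guard is upward closed and the conclusion
does not mention `s`), so the slack `(ℓ₄/(Rs))^M` was tested away at `s' := min 1 (ℓ₄/R)`; (C1)/(C2) the tempered onset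
clause contained its `s₀ := a` instance, i.e. the parent clause.  REV 2 re-types exactly along the critic's repair path:
(R1) **pin the test scale** — `PinnedTemperedCeiling` adds the hypothesis that `s` ITSELF carries the `∀L`-floors of level
`ε` (admissible scales = the top octave of the floor window; `ℓ₄/R` carries no floors, so the rescaling is dead and the
slack is a genuine UV slack measured from the onset); (R2) **level at the atom's own scale, ceiling form** —
`TemperedAtomCeilingsK` ∕ `TemperedMomentBoundA` carry E1's conclusion (far mirrors, all axes ∕ planes ∕ offsets) at level
`ε (s/a)^M` for atoms of scale `s > a`, bypassing E1's fixed-level interface; (R3) CAL ∕ E3T become genuine twins (no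
longer closed by C4/C5) and W's weighted clause is load-bearing.  Kernel-checked REV 2 certificates: `26791 ⇒ E_T`,
`MCU-K ⇒ TAC-K` (via landed E1), `TMB-A ⇒ SMB` (via landed E1), `WPkgW ⇒ WPkg`.

## The observation (wuc, applied to the E-wall) — unchanged
The leaf's data ∕ E0′ clauses test the lattice moments ONLY against `⁰𝒮` (flat to infinite order on the fat diagonal) and
E0′ lets the Schwartz index grow linearly in `n`; in the landed Whitney synthesis (`LevelMass.level_mass`, flatness order
`K` free) every POLYNOMIAL piece loss `ρ_j^{-K₀ n}` is paid by raising the index (`WhitneyPkgW`).  Through the E3 chain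
(synthesis scale `s_j = a t_b/ρ_j`, atom ceilings at level `ε_j`, 28168 `(C n^θ √ε_j)ⁿ`) the two-point input needed is
the `R⁻⁸` law AT THE ONSET UNIT with polynomial slack into the UV:
  `E_T`:  at a PINNED onset scale `s`, `|c_{q,k}(t)| ≤ (C/R⁴)² · (ℓ₄/(R s))^M` for SOME `M`   (`1 ≤ R ≤ ℓ₄/s`),
content only for `R ≳ (ℓ₄/s)^{M/(M+8)}` (below, the trivial bound wins): the deep-UV two-point law is not owed.

## Stubs (6) and composition
* N   `stub_onsetFloorsK : OnsetFloorsK` — BY NAME (K1 currency).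
* E_T `stub_pinnedTemperedCeiling : PinnedTemperedCeiling` — NEW (REV 2: pinned).  [E-wall n = 2, near-unit octaves]
* CAL `stub_temperedCalibrationK : OnsetFloorsK → PinnedTemperedCeiling → TemperedAtomCeilingsK` — twin of
  B6K ∘ MirrorDomination ∘ E1 with the slack carried into the level.  [L]
* W   `stub_weightedWhitneyPkg : WhitneyPkgW`.  [pure analysis, L; load-bearing for E3T]
* E3T `stub_temperedMomentBoundA : WhitneyPkgW → AtomicSqrtDominationR → TemperedMomentBoundA` — twin of E3 at
  piece-dependent level.  [L/XL]
* K2R `stub_atomicSqrtDominationR : AtomicSqrtDominationR` — item 28168 BY NAME.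
* composition `HypercubicOSDataFromInfiniteVolume_of_temperedPeak` (sorry-free) concludes the leaf BY NAME:
  `smearedIVDataK_proof (smearedIVInputK_of_temperedA (CAL N E_T) (E3T W K2R))`.

WHY NOVEL vs the listed lines on 19868 ∕ 28169 (CofinalWindows, CofinalFRS, MirrorCalibration REV 4∕5, AtomicEngine): all of
them consume the E-wall at full strength (26791 ∕ 26671 ∕ the onset twins of #90c: `R⁸c(R)` BOUNDED on every sub-unit
octave); none uses the flatness of `⁰𝒮` beyond summability of the Whitney masses.  Lever: «flatness buys polynomial UV slack».
CHEAPEST FALSIFIER ∕ instrument row: (i) SEPARATION (now meaningful, the scale being pinned): a reflection-positive lattice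
generalised free field with spectral weight `∝ m^{7−2κ}` on `[s/ℓ₄, 1]` obeys E_T at its onset scale (`M = ⌈2κ⌉`) and
violates 26791 there; (ii) KILL: E_T dies iff the dimensionless on-axis mirror covariance `R⁸c_{q,k}(R)` of SU(2) below
the onset unit grows FASTER than every power of `ℓ₄/(Rs)` uniformly in β; instrument = N18 smeared-slice readout of `R⁸c(R)`
across the top three octaves below the floors' unit at two β (slope calibrates `M`, β-growing curvature kills).
HONEST LABEL: a SKELETON; it proves no stub, no crux, no rung, no leaf and no summit; nothing about Bałaban's RG or Clay is
asserted; the Yang–Mills mass gap is NOT proved.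
-/

set_option autoImplicit false

noncomputable section

open scoped BigOperators
open MeasureTheory Filter Topology
open Literature.MathematicalPhysics.QuantumFieldTheory Literature.MathematicalPhysics.QuantumLattice
open Literature.MathematicalPhysics.AQFT (IsOffDiagonal)
open Summit.QuantumFields.YangMills.Theorems.InfiniteVolume (stateMomentStr)
open Summit.QuantumFields.YangMills.Cruxes.OSLegsFromFemtoAndGap.DlrCollarTransfer (Q2 Q3 torusE plane)
open Summit.QuantumFields.YangMills.Cruxes.AtomicCalibrationR.MirrorCalibration
  (SmearedMomentBound onsetSet IsAdmissibleProfile LowerBoundsK OnsetFloorsK MirrorCalibratedUnitK SmearedIVInputK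
    WhitneyPkg smearedIVDataK_proof atomWt reflSite AtomCeilings atomCeilings_holds)
open Summit.QuantumFields.YangMills.Theses.OnsetTautology (AtomicSqrtDominationR)
open Summit.QuantumFields.YangMills.Theses.SquareRootCeilings (AxisMirrorCeiling)

namespace Summit.QuantumFields.YangMills.Cruxes.HypercubicOSDataFromInfiniteVolume.TemperedPeak

/-! ## §1 The tempered currencies — REV 2 (pinned test scale; ceiling form at the atom's own scale) -/

/-- **E_T `PinnedTemperedCeiling`** (REV 2 of `TemperedAxisMirrorCeiling`) — item 26791 `SquareRootCeilings.AxisMirrorCeiling`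
VERBATIM (same `∀β` onset-floor antecedent, same sub-onset guard, same on-axis mirror pairs `t ∈ [2R+2, L]`, `Rs ≤ ℓ₄`,
`4R+8 ≤ L`) with TWO changes: (i) the test scale `s` is PINNED to the onset — the extra hypothesis that `s` ITSELF carries the
`∀L`-floors of level `ε` (so the admissible scales are no longer upward closed: `s` lies within one octave of the top of the
floor window; idea-crit-9 #95 (C3) showed that without the pin the slack can be tested away at `s' := min 1 (ℓ₄/R)`);
(ii) the conclusion is TEMPERED: `|c_{q,k}(t)| ≤ (C/R⁴)² · (ℓ₄/(R s))^M` for SOME `M : ℕ`.  `26791 ⇒ E_T` (`M = 0`, pin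
ignored: `pinnedTempered_of_axisMirror`); `E_T ⇏ 26791` by rescaling, because `ℓ₄/R` carries no floors. -/
def PinnedTemperedCeiling : Prop :=
  ∀ (G : Type) [Group G] [TopologicalSpace G] [IsTopologicalGroup G] [CompactSpace G],
    IsCompactSimpleLieGroup G → Nonempty (G ≃ₜ* Matrix.specialUnitaryGroup (Fin 2) ℂ) →
    letI : MeasurableSpace G := borel G
    haveI : BorelSpace G := ⟨rfl⟩
    ∀ (r : LatticeRep G) (v f g h : SchwartzMap (EuclideanSpace ℝ (Fin 4)) ℝ) (Λ₅ : ℝ), ∃ ε₀ : ℝ, 0 < ε₀ ∧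
      ∀ ε : ℝ, 0 < ε → ε ≤ ε₀ →
        (∃ β₅ : ℝ, ∀ β : ℝ, β₅ ≤ β → ∃ s : ℝ, 0 < s ∧ s ≤ 1 ∧
            (∀ L : ℕ, Λ₅ ≤ s * L → ε ≤ Q2 G r β L s (thetaTest 4 v) v) ∧
            (∀ L : ℕ, Λ₅ ≤ s * L → ε ≤ |Q3 G r β L s f g h|)) →
        ∃ (M : ℕ) (C ℓ₄ β₄ : ℝ), 0 < ℓ₄ ∧ 0 ≤ C ∧ ∀ β : ℝ, β₄ ≤ β → ∀ s : ℝ, 0 < s → s ≤ 1 →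
          (∀ s' : ℝ, 2 * s ≤ s' → s' ≤ 1 →
            ¬ ((∀ L : ℕ, Λ₅ ≤ s' * L → ε ≤ Q2 G r β L s' (thetaTest 4 v) v) ∧
               (∀ L : ℕ, Λ₅ ≤ s' * L → ε ≤ |Q3 G r β L s' f g h|))) →
          ((∀ L : ℕ, Λ₅ ≤ s * L → ε ≤ Q2 G r β L s (thetaTest 4 v) v) ∧
            (∀ L : ℕ, Λ₅ ≤ s * L → ε ≤ |Q3 G r β L s f g h|)) →
          ∀ (L : ℕ) (q : Fin 4 × Fin 4) (k : Fin 4) (R t : ℕ), q.1 < q.2 → 1 ≤ R → (R : ℝ) * s ≤ ℓ₄ →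
            4 * R + 8 ≤ L → 2 * R + 2 ≤ t → t ≤ L →
            |torusE G r β L (fun U =>
                (plane G r q (fun i => if i = k then (t : ℤ) else 0) U -
                    torusE G r β L (plane G r q (fun i => if i = k then (t : ℤ) else 0))) *
                  (plane G r q (fun _ => 0) U - torusE G r β L (plane G r q (fun _ => 0))))| ≤
              (C / (R : ℝ) ^ 4) ^ 2 * (ℓ₄ / ((R : ℝ) * s)) ^ M

/-- **TAC-K `TemperedAtomCeilingsK`** (REV 2 of `TemperedCalibratedUnitK`; answers #95 (C1)) — the calibrated unit `a(β)`
(floors `LowerBoundsK G r a`, `a β ≤ 1`) together with TEMPERED ATOM CEILINGS IN CEILING FORM AT THE ATOM'S OWN SCALE: in every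
odd-torus limit state at `β ≥ β₇`, every single-orientation `b`-atom of scale `s > a β` (finer than the unit) lying on one side
of a lattice hyperplane `x_k = c` at lattice distance `≥ t/s + 2` from its carrier has reflected two-body square
`≤ ε · (s / a β)^M` — E1's conclusion (`AtomCeilings`, all axes ∕ planes ∕ offsets, far mirrors) with the level GROWING
polynomially toward the UV.  `M = 0` at fixed level is what `MirrorCalibratedUnitK` + the landed E1 give
(`temperedAtomCeilingsK_of_mirror`); the converse fails (the level is scale-dependent and the mirror regime is E1's, not the
onset set's). -/
def TemperedAtomCeilingsK : Prop :=
  ∀ (G : Type) [Group G] [TopologicalSpace G] [IsTopologicalGroup G] [CompactSpace G],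
    IsCompactSimpleLieGroup G → Nonempty (G ≃ₜ* Matrix.specialUnitaryGroup (Fin 2) ℂ) →
    letI : MeasurableSpace G := borel G
    haveI : BorelSpace G := ⟨rfl⟩
    ∃ (r : LatticeRep G) (a : ℝ → ℝ) (b : SchwartzMap (EuclideanSpace ℝ (Fin 4)) ℝ) (ε : ℝ) (M : ℕ),
      IsAdmissibleProfile b ∧ 0 < ε ∧ (∀ β, 0 < a β) ∧ Tendsto a atTop (nhds 0) ∧ LowerBoundsK G r a ∧
      ∃ β₇ : ℝ, ∀ β : ℝ, β₇ ≤ β → a β ≤ 1 ∧ ∀ μ ∈ oddTorusLimitPoints r β,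
          ∀ (S : Finset ((Fin 4 × Fin 4) × (Fin 4 → ℤ))) (q : Fin 4 × Fin 4) (s t : ℝ) (y : EuclideanSpace ℝ (Fin 4))
            (k : Fin 4) (c : ℤ), q.1 < q.2 → 0 < s → a β < s → (∀ u, b u ≠ 0 → ‖u‖ ≤ t) →
            (∀ p, atomWt b {q} s y p ≠ 0 → p ∈ S) →
            ((∀ p ∈ S, ((p.2 k : ℤ) : ℝ) + t / s + 2 ≤ (c : ℝ)) ∨ (∀ p ∈ S, (c : ℝ) + t / s + 2 ≤ ((p.2 k : ℤ) : ℝ))) →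
            ∑ p ∈ S, ∑ p' ∈ S, atomWt b {q} s y p * atomWt b {q} s y p' *
                stateMomentStr G r μ 2 ![p.1, p'.1] ![reflSite k c p, p'.2] ≤ ε * (s / a β) ^ M

/-- **E3T `TemperedMomentBoundA`** (REV 2 of `TemperedMomentBound`; answers #95 (C2)) — `SmearedMomentBound` (E3 currency) with its
onset-domination hypothesis REPLACED by tempered atom ceilings in ceiling form at the atom's own scale (level `ε (s/a)^M` for
atoms of scale `s > a`, far mirrors, all axes), for every `M` (constants may depend on `M`); conclusion character for character
the leaf's DATA functional bound.  `⇒ SmearedMomentBound` via the landed E1 (`smearedMomentBound_of_temperedA`). -/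
def TemperedMomentBoundA : Prop :=
  ∀ (M : ℕ) (G : Type) [Group G] [TopologicalSpace G] [IsTopologicalGroup G] [CompactSpace G],
    IsCompactSimpleLieGroup G → Nonempty (G ≃ₜ* Matrix.specialUnitaryGroup (Fin 2) ℂ) →
    letI : MeasurableSpace G := borel G
    haveI : BorelSpace G := ⟨rfl⟩
    ∀ (r : LatticeRep G) (b : SchwartzMap (EuclideanSpace ℝ (Fin 4)) ℝ) (ε : ℝ), IsAdmissibleProfile b → 0 < ε →
      ∃ (c : ℕ → ℝ) (N : ℕ) (α C γ β₄ : ℝ), (∀ n, 0 ≤ c n ∧ c n ≤ α * C ^ n * (n.factorial : ℝ) ^ γ) ∧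
        ∀ β : ℝ, β₄ ≤ β → ∀ μ ∈ oddTorusLimitPoints r β, ∀ a : ℝ, 0 < a → a ≤ 1 →
          (∀ (S : Finset ((Fin 4 × Fin 4) × (Fin 4 → ℤ))) (q : Fin 4 × Fin 4) (s t : ℝ) (y : EuclideanSpace ℝ (Fin 4))
            (k : Fin 4) (c : ℤ), q.1 < q.2 → 0 < s → a < s → (∀ u, b u ≠ 0 → ‖u‖ ≤ t) →
            (∀ p, atomWt b {q} s y p ≠ 0 → p ∈ S) →
            ((∀ p ∈ S, ((p.2 k : ℤ) : ℝ) + t / s + 2 ≤ (c : ℝ)) ∨ (∀ p ∈ S, (c : ℝ) + t / s + 2 ≤ ((p.2 k : ℤ) : ℝ))) →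
            ∑ p ∈ S, ∑ p' ∈ S, atomWt b {q} s y p * atomWt b {q} s y p' *
                stateMomentStr G r μ 2 ![p.1, p'.1] ![reflSite k c p, p'.2] ≤ ε * (s / a) ^ M) →
          ∀ (n : ℕ) (q : Fin n → Fin 4 × Fin 4), 2 ≤ n → (∀ i, (q i).1 < (q i).2) →
            ∀ F : SchwartzMap (Fin n → EuclideanSpace ℝ (Fin 4)) ℂ, IsOffDiagonal F →
              ‖∑' x : Fin n → (Fin 4 → ℤ), ((stateMomentStr G r μ n q x : ℝ) : ℂ) *
                  F (fun l => a • siteToE (x l) +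
                    (a / 2) • (EuclideanSpace.single (q l).1 (1 : ℝ) + EuclideanSpace.single (q l).2 (1 : ℝ)))‖ ≤
                c n * schwartzNorm (N * n) F

/-- **W `WhitneyPkgW`** — the off-diagonal Whitney package E2 (`WhitneyPkg`, landed `stub_offDiagonalWhitney`) WITH WEIGHTS:
for every loss exponent `K₀` the pieces may be chosen so that the WEIGHTED mass `Σ_j M_j / ρ_j^{K₀ n}` obeys the same
E0′-compatible bound `≤ α Cⁿ (n!)^γ ‖F‖_{Nn}` (flatness of `⁰𝒮` at the fat diagonal to order `K + K₀ n`; all other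
clauses character for character E2).  `⇒ WhitneyPkg` (`K₀ = 0`, `whitneyPkg_of_W`). -/
def WhitneyPkgW : Prop :=
  ∀ (Λ : ℝ) (N' K₀ : ℕ), 1 ≤ Λ → ∃ (N : ℕ) (α C γ : ℝ), 0 ≤ α ∧ 0 ≤ C ∧ 0 ≤ γ ∧ ∀ (n : ℕ), 1 ≤ n →
    ∀ F : SchwartzMap (Fin n → EuclideanSpace ℝ (Fin 4)) ℂ, IsOffDiagonal F →
      ∃ (κ : ℕ → ℂ) (Gp : ℕ → SchwartzMap (Fin n → EuclideanSpace ℝ (Fin 4)) ℝ)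
        (cp : ℕ → Fin n → EuclideanSpace ℝ (Fin 4)) (ρ M : ℕ → ℝ),
        (∀ j, ‖κ j‖ ≤ 1) ∧ (∀ j, 0 < ρ j ∧ ρ j ≤ 1 / 2) ∧
        (∀ j, tsupport (Gp j) ⊆ {z | ∀ l, ‖z l - cp j l‖ ≤ ρ j}) ∧
        (∀ j (l l' : Fin n), l ≠ l' → ∃ k : Fin 4, Λ * ρ j ≤ |cp j l k - cp j l' k|) ∧
        (∀ j (m : ℕ), m ≤ N' * n → ∀ z, ‖iteratedFDeriv ℝ m (Gp j) z‖ ≤ M j / ρ j ^ m) ∧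
        (∀ j, 0 ≤ M j) ∧ Summable M ∧
        ∑' j, M j ≤ α * C ^ n * (n.factorial : ℝ) ^ γ * schwartzNorm (N * n) F ∧
        Summable (fun j => M j / ρ j ^ (K₀ * n)) ∧
        ∑' j, M j / ρ j ^ (K₀ * n) ≤ α * C ^ n * (n.factorial : ℝ) ^ γ * schwartzNorm (N * n) F ∧
        ∀ z, HasSum (fun j => κ j * ((Gp j z : ℝ) : ℂ)) (F z)

/-! ## §2 The wuc certificates and the glue (sorry-free) -/

/-- `26791 ⇒ E_T`: take `M = 0` and ignore the pin. [wuc certificate] -/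
theorem pinnedTempered_of_axisMirror (hA : AxisMirrorCeiling) : PinnedTemperedCeiling := by
  intro G _ _ _ _ hG hcl
  letI : MeasurableSpace G := borel G
  haveI : BorelSpace G := ⟨rfl⟩
  intro r v f g h' Λ₅
  obtain ⟨ε₀, hε₀, hh⟩ := hA G hG hcl r v f g h' Λ₅
  refine ⟨ε₀, hε₀, fun ε hε hεε hfl => ?_⟩
  obtain ⟨C, ℓ₄, β₄, hℓ₄, hC, hmain⟩ := hh ε hε hεε hfl
  refine ⟨0, C, ℓ₄, β₄, hℓ₄, hC, ?_⟩
  intro β hβ s hs hs1 hsub _hpin L q k R t hq hR hRs hL hRt htL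
  simpa only [pow_zero, mul_one] using hmain β hβ s hs hs1 hsub L q k R t hq hR hRs hL hRt htL

/-- `MirrorCalibratedUnitK ⇒ TemperedAtomCeilingsK`: `M = 0`, the ceiling form supplied by the LANDED E1 `atomCeilings_holds`.
[wuc certificate] -/
theorem temperedAtomCeilingsK_of_mirror (hU : MirrorCalibratedUnitK) : TemperedAtomCeilingsK := by
  intro G _ _ _ _ hG hcl
  letI : MeasurableSpace G := borel G
  haveI : BorelSpace G := ⟨rfl⟩
  obtain ⟨r, a, b, ε, hb, hε, hapos, ha0, hLB, β₇, hβ₇⟩ := hU G hG hcl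
  refine ⟨r, a, b, ε, 0, hb, hε, hapos, ha0, hLB, max β₇ 0, fun β hβ => ⟨(hβ₇ β (le_of_max_le_left hβ)).1, ?_⟩⟩
  intro μ hμ S q s t y k c hq hs has ht hS hfar
  have hE1 := atomCeilings_holds G hG hcl r b ε β (a β) μ hb hε (le_of_max_le_right hβ) hμ
    ((hβ₇ β (le_of_max_le_left hβ)).2 μ hμ) S q s t y k c hq hs has ht hS hfar
  simpa only [pow_zero, mul_one] using hE1

/-- `TemperedMomentBoundA ⇒ SmearedMomentBound`: at `M = 0` the ceiling-form hypothesis follows from onset domination by the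
LANDED E1. [wuc certificate] -/
theorem smearedMomentBound_of_temperedA (hT : TemperedMomentBoundA) : SmearedMomentBound := by
  intro G _ _ _ _ hG hcl
  letI : MeasurableSpace G := borel G
  haveI : BorelSpace G := ⟨rfl⟩
  intro r b ε hb hε
  obtain ⟨c, N, α, C, γ, β₄, hc, hbd⟩ := hT 0 G hG hcl r b ε hb hε
  refine ⟨c, N, α, C, γ, max β₄ 0, hc, ?_⟩
  intro β hβ μ hμ a ha ha1 hons n q hn hq F hF
  refine hbd β (le_of_max_le_left hβ) μ hμ a ha ha1 ?_ n q hn hq F hF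
  intro S q' s t y k c' hq' hs has ht hS hfar
  have hE1 := atomCeilings_holds G hG hcl r b ε β a μ hb hε (le_of_max_le_right hβ) hμ hons
    S q' s t y k c' hq' hs has ht hS hfar
  simpa only [pow_zero, mul_one] using hE1

/-- `WhitneyPkgW ⇒ WhitneyPkg` (`K₀ = 0`, forget the weighted clauses). [bookkeeping] -/
theorem whitneyPkg_of_W (hW : WhitneyPkgW) : WhitneyPkg := by
  intro Λ N' hΛ
  obtain ⟨N, α, C, γ, hα, hC, hγ, hh⟩ := hW Λ N' 0 hΛ
  refine ⟨N, α, C, γ, hα, hC, hγ, fun n hn F hF => ?_⟩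
  obtain ⟨κ, Gp, cp, ρ, M, h1, h2, h3, h4, h5, h6, h7, h8, -, -, h9⟩ := hh n hn F hF
  exact ⟨κ, Gp, cp, ρ, M, h1, h2, h3, h4, h5, h6, h7, h8, h9⟩

/-- **Glue (pure logic)** — the calibrated unit with tempered atom ceilings and the tempered moment bound at ITS exponent `M`
assemble the K-input package of the landed smeared engine (twin of K1's `smearedIVInputK_of`). -/
theorem smearedIVInputK_of_temperedA (hU : TemperedAtomCeilingsK) (hS : TemperedMomentBoundA) : SmearedIVInputK := by
  intro G _ _ _ _ hG hcl
  letI : MeasurableSpace G := borel G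
  haveI : BorelSpace G := ⟨rfl⟩
  obtain ⟨r, a, b, ε, M, hb, hε, hapos, ha0, hLB, β₇, hβ₇⟩ := hU G hG hcl
  obtain ⟨c, N, α, C, γ, β₄, hc, hbd⟩ := hS M G hG hcl r b ε hb hε
  refine ⟨r, a, c, N, α, C, γ, max β₄ β₇, hapos, ha0, hLB, hc, ?_⟩
  intro β hβ μ hμ n q hn hq F hF
  exact hbd β (le_of_max_le_left hβ) μ hμ (a β) (hapos β) (hβ₇ β (le_of_max_le_right hβ)).1
    ((hβ₇ β (le_of_max_le_right hβ)).2 μ hμ) n q hn hq F hF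

/-! ## §3 The stubs (6) -/

/-- ★ **N `stub_onsetFloorsK`** — the shared onset-floor residual in the compact-witness currency BY NAME (K1; = B4K of
«MirrorCalibration» REV 5).  [N-wall; hard; residual-fed] -/
theorem stub_onsetFloorsK : OnsetFloorsK := by
  sorry

/-- ★ **E_T `stub_pinnedTemperedCeiling`** — the tempered on-axis mirror ceiling AT THE PINNED ONSET SCALE (this line's new
E-input; `∃ M`).  First move (dyadic form, LINE «OctaveDoubling» REV 2): pinned top-octave ceiling `+` pinned octave step.
[E-wall n = 2, on-axis, near-unit octaves; strictly inside 26791 — `E_T ⇏ 26791` since the pin kills the rescaling] -/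
theorem stub_pinnedTemperedCeiling : PinnedTemperedCeiling := by
  sorry

/-- ★ **CAL `stub_temperedCalibrationK`** — tempered mirror calibration IN CEILING FORM, the twin of the LANDED B6K
`mirrorCalibrationK_proof` (§1–§7) with the slack carried: the joint onset unit `a(β)` of `jointOnsetUnit` (landed,
`…MirrorCalibrationOnset`) carries BOTH `∀L`-floors (`(hcal β hβ).1`) and the guard (`(hcal β hβ).2`) — it IS E_T's pinned
test scale, so E_T is instantiated at `s := a β` (no re-test is possible or needed); the torus ceiling passes to the limit
states (`twoPoint_limitState`), general pairs are dominated by on-axis mirror pairs (RP Cauchy–Schwarz, the landed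
`MirrorDomination.abs_cov_le_of_axisMirror`, same `R`, same slack), and the far-mirror square of an atom of scale
`s > K·aβ` is summed pair by pair as in `rpSquare_le_fine`/`rpSquare_le_coarse` (now for every axis ∕ plane ∕ offset, the
E1 geometry): its pairs sit at `R ≳ t_b/s` when `s < t_b` and at `R ≥ 1` with `s ≥ t_b` otherwise, so the slack
`(ℓ₄/(R aβ))^M ≤ (K ℓ₄/t_b)^M · (s/(K aβ))^M` in both regimes and is absorbed into the level `ε (s/a'β)^M`, `a' := K a`
(floors transported by `lowerBoundsK_const_mul_iff`, `a' → 0` by `onsetVanishes_proof` as in B6K).  [provable-grade twin; L] -/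
theorem stub_temperedCalibrationK :
    OnsetFloorsK → PinnedTemperedCeiling → TemperedAtomCeilingsK := by
  sorry

/-- ★ **W `stub_weightedWhitneyPkg`** — the weighted off-diagonal Whitney package (re-run of the landed
`WhitneyAssembly.whitneyPkg_of_gevrey` with flatness order `K + K₀ n` in `LevelMass.level_mass`); its weighted clause is
LOAD-BEARING for E3T below.  [pure analysis; L] -/
theorem stub_weightedWhitneyPkg : WhitneyPkgW := by
  sorry

/-- ★ **E3T `stub_temperedMomentBoundA`** — the tempered all-order smeared bound: E3's proof (`smearedAtomicBound_proof` with the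
landed `atomicSynthesis_proof'`), the E1-output it consumes now being the HYPOTHESIS at the piece-dependent level
`ε_j = ε (s_j/a)^M` (`s_j = a t_b/ρ_j` the synthesis scale of a piece of radius `ρ_j`), the loss `(t_b/ρ_j)^{Mn/2}` of
`(C n^θ √ε_j)ⁿ` (28168) absorbed by the weighted Whitney mass with `K₀ = ⌈M/2⌉`.  [provable-grade twin of E3; L/XL] -/
theorem stub_temperedMomentBoundA : WhitneyPkgW → AtomicSqrtDominationR → TemperedMomentBoundA := by
  sorry

/-- ★ **K2R `stub_atomicSqrtDominationR`** — item 28168 `OnsetTautology.AtomicSqrtDominationR` BY NAME.  [E-wall n ≥ 3; by name] -/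
theorem stub_atomicSqrtDominationR : AtomicSqrtDominationR := by
  sorry

/-! ## §4 The composition (sorry-free) -/

/-- **The composition** — concludes the leaf 19868 BY NAME from the six stubs. -/
theorem HypercubicOSDataFromInfiniteVolume_of_temperedPeak :
    Summit.QuantumFields.YangMills.Theses.InfiniteVolumeContinuum.HypercubicOSDataFromInfiniteVolume :=
  smearedIVDataK_proof
    (smearedIVInputK_of_temperedA (stub_temperedCalibrationK stub_onsetFloorsK stub_pinnedTemperedCeiling)
      (stub_temperedMomentBoundA stub_weightedWhitneyPkg stub_atomicSqrtDominationR))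

end Summit.QuantumFields.YangMills.Cruxes.HypercubicOSDataFromInfiniteVolume.TemperedPeak

end
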